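import Mathlib.Data.Nat.Pairing
import Mathlib.Data.Set.Card
import Mathlib.Data.Set.Finite.List
import Literature.Computability.MetaComplexity.UniversalHeuristicSchemesProofs
import Literature.Computability.MetaComplexity.UHSParameters
import Literature.Computability.MetaComplexity.DistProblems
import Literature.Computability.MetaComplexity.DirectProductGenerator
import Literature.Computability.Complexity.UniformProbBlocks
import Literature.Computability.Complexity.UnaryArithMachines
import Literature.Computability.AlgebraicComplexity.ValiantClasses
import HarnessLib

/-!
# Complexity meta: the universal heuristic scheme for the search version of `UP` (Hirahara 2021, proof of Thm. 8.9) — correctness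

Topic `Literature/Computability/MetaComplexity`, companion to `SearchHeuristicSchemes.lean` (Def. 8.8
and the named fact `Hirahara2021_UP_searchUHS_of_Avg1P` = Thm. 8.9 for `UP`-type verifiers),
`LanguageCompression.lean` (Lemma 5.1, Thm. 4.2, Thm. 5.2), `DirectProductGenerator.lean` (`DP_k`,
`dpAdvantage`), `KtApproximation.lean` (Fact 3.8) and `AccProbTester.lean` (Eq. (13)) for
S. Hirahara, *Average-case hardness of NP from exponential worst-case hardness assumptions*, STOC
2021, full version ECCC TR21-058. This file formalises the **correctness part of the proof of
Thm. 8.9** (pp. 40–42) for a `UP`-type verifier `(R, p)` (at most one certificate per input — then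
the hashing Lemma 8.5 is not needed, `W(x, y, y′, r) := V(x, y)`, and the random string `r`
disappears): the construction of the checker `C` and the solver `S` from the ingredients of the
proof, and Claims 8.10 and 8.11, with all parameters explicit. Polynomial running time of the
scheme is established separately (machine files); the ingredients themselves are inputs:

* `UPToolkit U R p` — the data and guarantees delivered by the five cited ingredients, exactly as
  the proof uses them: cheap printing (`K^t(x) ≤ |x| + a₀`, `exists_ktAt_le_length_add`),
  **Lemma 5.1 + Fact 3.8** (`τ`, `s = sK(x,t)` with Eq. (12); supplied by `KtApproximation.lean`
  from `Hirahara2021_gapKvsK_mem_PromiseP`), **Thm. 4.2** for the ensemble `L'` (`p♯`, separator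
  `M`; `Hirahara2021_languageCompression`), **Lemma 3.4** as the derandomised estimator of Eq. (13)
  (`Tst`; `AccProbTester.lean` from `PromiseBPP' ⊆ PromiseP`), **Thm. 3.12** in enumeration form
  (`enum`), **Thm. 5.2** (`p₀`, `p_w`; `Hirahara2021_weakSymmetryOfInformation`);
* `UniversalMachine.upSlice` — the slice `L'_{⟨n,k,t,s⟩}` of the language ensemble of the proof
  (`x ‖ DP_k(ỹ; z)` with `|x| = n`, `K^t(x) ≤ s`, `ỹ = padCert p(n) y` for a certificate `y`), its
  size bound `log |L'_{⟨n,k,t,s⟩}| ≤ s + (p(n)+1)k` (`log_ncard_upSlice_le`, the paper's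
  "`log |L'| ≤ s + |w| + |r| - k + log p(n) + 2`"), the index coding `idx4` (`⟨n,k,t,s⟩`);
* the scheme (`namespace UPToolkit`): parameters `t' = τ(n+t)`, slack `Λ(t) = c(log(t+2)+1)`,
  `k' = k + Λ(t)`, queried index `ι' = ⟨n,k',t',s⟩`, `m' = (p(n)+1)k' + k'`, the analysis-only time
  bound `T = p♯(ι') + p₀(n m')`; `checkerCore`/`solverCore` and the capped `checker`/`solver`
  (`k̄ = min k (n + a₀)`, harmless since `cd^{t,q(t)}(x) ≤ K^t(x) ≤ n + a₀`);
* **Claim 8.11** `solverCore_mem_certSet`: acceptance and a certificate force `S` to output a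
  certificate (the test `D(w) := M(x, w; 1^{ι'})` accepts every `DP_{k'}(ỹ; z)` and at most `2/3` of
  the uniform strings, so `ỹ` is `1/3`-reconstructed by Thm. 3.12 and found in the list);
* **Claim 8.10** `noInstance_of_soi` + `checkerCore_eq_true`: small depth `cd^{t,q(t)}(x) ≤ k` forces
  acceptance (weak symmetry of information puts all but `1/32` of the `w` into the no-part of the
  compression problem, which `M` rejects, so the estimator accepts), given the parameter constraints;
* the parameter bookkeeping (footnote 24 of the paper, "so that `t` is the largest parameter"):
  polynomial bounds `F1 … BIG` (`IsPBounded`), `lam_le_self`, the choice of the slack constant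
  (`exists_slack_const`, via `UHSParam.exists_pow_bound`) and of the scheme polynomial
  (`exists_scheme_poly`, `exists_good_params`);
* **`UPToolkit.scheme_correct`** — items (1) and (2) of Def. 8.8 for the capped scheme with some
  slack constant `c` and polynomial `q`: `∀ x, ∀ t ≥ q(|x|), ∀ k`, `cd^{t,q(t)}(x) ≤ k ⟹ C = 1`, and
  `C = 1 ∧ (x has a certificate) ⟹ S(x; 1ᵗ, 1^{2^k})` is a certificate.

## Deviations from print (documented, not weakening the target)

* `UP` instead of `NP_sv`: no hashing, no `r`; constants `1/32`, `2/3`, `1/3` in place of `δ, 2δ, 3δ`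
  with `δ = 1/24` (no Markov step needed).
* Certificates of the tree's verifiers have length `≤ p(n)`; they are padded injectively to length
  `p(n)+1` (`padCert`, `1^{p(n)-|y|} ‖ 0 ‖ y`) before `DP_k` is applied.
* `k` is capped at `n + a₀`, and the slack `Λ(t)` is an explicit `c (log (t+2) + 1)`; the paper's
  `k' := k + log p*(t') + log p_K(t) + log p_w(t'') + 1` is recovered as the inequality `hlam`.
* Weak symmetry of information is invoked at `T = p♯(ι') + p₀(n m')` (so that its hypothesis
  `t ≥ p₀(nm)` holds) rather than at `t'' = p*(t')`; antitonicity of `K^t` absorbs the change.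

## References

* S. Hirahara, *Average-case hardness of NP from exponential worst-case hardness assumptions*,
  STOC 2021; full version ECCC TR21-058: Def. 8.8, Thm. 8.9 and its proof, Eq. (12)–(13),
  Claims 8.10–8.11 (pp. 40–42); Fact 3.7, Def. 3.10, Thm. 3.12, Thm. 4.2, Lemma 5.1, Thm. 5.2.
* S. Arora, B. Barak, *Computational Complexity: A Modern Approach*, CUP 2009, §2.1 (certificates).
-/

namespace Literature.Computability.MetaComplexity

open _root_.Computability Complexity

/-! ### Counting-probability helpers -/

/-- Monotonicity of the counting probability. (Same statement as `PromiseCook.uniformProb_mono` of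
`PromiseCookMachine.lean` and two other copies, none importable below this file; librarian: hoist into
`Randomized.lean`.) [Arora–Barak 2009, §A.2] [folklore] -/
theorem uniformProb_mono' {m : ℕ} {E E' : Set (List Bool)} (h : E ⊆ E') :
    uniformProb m E ≤ uniformProb m E' := by
  classical
  unfold uniformProb
  refine div_le_div_of_nonneg_right ?_ (by positivity)
  exact_mod_cast Finset.card_le_card fun r hr => by
    simp only [Finset.mem_filter, Finset.mem_univ, true_and] at hr ⊢
    exact h hr

/-- An event containing every string of length `m` has counting probability `1`. [folklore] -/
theorem uniformProb_eq_one_of_forall {m : ℕ} {E : Set (List Bool)}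
    (h : ∀ v : List Bool, v.length = m → v ∈ E) : uniformProb m E = 1 := by
  classical
  unfold uniformProb
  rw [Finset.filter_true_of_mem fun r _ => h r.toList r.toList_length, Finset.card_univ, card_vector,
    Fintype.card_bool]
  push_cast
  exact div_self (by positivity)

/-! ### Certificate padding -/

/-- Fixed-length, injective padding of certificates of length `≤ N` to length `N + 1`:
`y ↦ 1^{N-|y|} ‖ 0 ‖ y` (a block of `1`s, a separator, then `y`; unpadding is the tree's total
parser `splitOnes`). (The proof of Thm. 8.9 feeds certificates of a fixed length `p(n)` to `DP_k`;
the tree's `UP` verifiers accept certificates of length `≤ p(n)`, whence the padding.)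
[Hirahara 2021 (ECCC TR21-058), proof of Thm. 8.9 (`|y| = p(n)`)] [folklore] -/
def padCert (N : ℕ) (y : List Bool) : List Bool :=
  ones (N - y.length) ++ false :: y

/-- Inverse of the padding: skip the leading `1`s and the separator (`splitOnes`). [folklore] -/
def unpadCert (u : List Bool) : List Bool :=
  (splitOnes u).2

/-- The padded certificate has length `N + 1` when `|y| ≤ N`. [folklore] -/
theorem length_padCert {N : ℕ} {y : List Bool} (h : y.length ≤ N) : (padCert N y).length = N + 1 := by
  simp [padCert]
  omega

/-- Unpadding inverts padding. [folklore] -/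
@[simp] theorem unpadCert_padCert (N : ℕ) (y : List Bool) : unpadCert (padCert N y) = y := by
  simp [unpadCert, padCert]

/-- Padding is injective (everywhere). [folklore] -/
theorem padCert_injective (N : ℕ) : Function.Injective (padCert N) := fun y y' h => by
  have := congr_arg unpadCert h
  simpa using this

/-! ### The index coding `⟨n, k, t, s⟩` -/

/-- The paper's tuple index `⟨n, k, t, s⟩ ∈ ℕ` of the language ensemble `L'` (Mathlib's `Nat.pair`,
nested). [Hirahara 2021 (ECCC TR21-058), proof of Thm. 8.9 (`L'_{⟨n,k,t,s⟩}`)] [folklore] -/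
def idx4 (n k t s : ℕ) : ℕ :=
  Nat.pair n (Nat.pair k (Nat.pair t s))

/-- The index coding is injective. [folklore] -/
theorem idx4_inj {n k t s n' k' t' s' : ℕ} (h : idx4 n k t s = idx4 n' k' t' s') :
    n = n' ∧ k = k' ∧ t = t' ∧ s = s' := by
  simp only [idx4, Nat.pair_eq_pair] at h
  tauto

/-- `Nat.pair` is monotone in both arguments (from its strict monotonicity in each). [folklore] -/
theorem pair_le_pair {a a' b b' : ℕ} (ha : a ≤ a') (hb : b ≤ b') : Nat.pair a b ≤ Nat.pair a' b' := by
  have h1 : Nat.pair a b ≤ Nat.pair a' b := by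
    rcases ha.eq_or_lt with rfl | hlt
    · exact le_rfl
    · exact (Nat.pair_lt_pair_left b hlt).le
  have h2 : Nat.pair a' b ≤ Nat.pair a' b' := by
    rcases hb.eq_or_lt with rfl | hlt
    · exact le_rfl
    · exact (Nat.pair_lt_pair_right a' hlt).le
  exact h1.trans h2

/-- The index coding is monotone in every component. [folklore] -/
theorem idx4_mono {n k t s n' k' t' s' : ℕ} (hn : n ≤ n') (hk : k ≤ k') (ht : t ≤ t') (hs : s ≤ s') :
    idx4 n k t s ≤ idx4 n' k' t' s' :=
  pair_le_pair hn (pair_le_pair hk (pair_le_pair ht hs))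

/-- `Nat.pair a b ≤ (a + b + 1)^2`. (Same statement as `AlgebraicComplexity.pair_le_sq` of
`BurgisserTransferProofs.lean`, whose import closure — counting hierarchy — is not wanted here.)
[folklore] -/
theorem pair_le_sq (a b : ℕ) : Nat.pair a b ≤ (a + b + 1) ^ 2 :=
  (Nat.pair_lt_max_add_one_sq a b).le.trans (Nat.pow_le_pow_left (by omega) 2)

/-! ### The slices of the language ensemble `L'` -/

/-- The set of certificates of `x` for the verifier `(R, p)`: `|y| ≤ p(|x|)` and `⟨x, y⟩ ∈ R`.
[Hirahara 2021 (ECCC TR21-058), Def. 8.1] [folklore] -/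
def certSet (R : Language Bool) (p : Polynomial ℕ) (x : List Bool) : Set (List Bool) :=
  {y | y.length ≤ p.eval x.length ∧ boolPair x y ∈ R}

namespace UniversalMachine

variable (U : UniversalMachine)

/-- **The slice `L'_{⟨n,k,t,s⟩}` of the language ensemble of the proof of Thm. 8.9**, for a
`UP`-type verifier `(R, p)` (so that the hashing of Lemma 8.5 is not needed: `W(x, y, y', r) := V(x, y)`
and the random string `r` is dropped): the strings `x ‖ w` with `|x| = n`, `K^t(x) ≤ s` and
`w = DP_k(ỹ; z)` for the padded certificate `ỹ = padCert p(n) y` of a certificate `y` of `x` and a seed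
`z ∈ {0,1}^{(p(n)+1)k}`. (Printed: `(x, w, r) ∈ L'_{⟨n,k,t,s⟩}` iff `∃ y, y', z` with `|x| = n`,
`|r| = |y| = |y'| = p(n)`, `K^t(x) ≤ s`, `w = DP_k(y; z)`, `W(x, y, y', r) = 1`.)
[Hirahara 2021 (ECCC TR21-058), proof of Thm. 8.9 (p. 40)] [cite: Hirahara2021, Thm. 8.9 (proof)] -/
def upSlice (R : Language Bool) (p : Polynomial ℕ) (n k t s : ℕ) : Set (List Bool) :=
  {v | ∃ x y z : List Bool, v = x ++ dpGen k (padCert (p.eval n) y) z ∧ x.length = n ∧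
    U.ktAt t x ≤ s ∧ y ∈ certSet R p x ∧ z.length = (p.eval n + 1) * k}

variable {U}

/-- Membership of a concatenation `x ‖ DP_k(ỹ; z)` in the slice. [Hirahara 2021 (ECCC TR21-058),
proof of Thm. 8.9] [cite: Hirahara2021, Thm. 8.9 (proof)] -/
theorem append_dpGen_mem_upSlice {R : Language Bool} {p : Polynomial ℕ} {n k t s : ℕ}
    {x y z : List Bool} (hx : x.length = n) (hK : U.ktAt t x ≤ s) (hy : y ∈ certSet R p x)
    (hz : z.length = (p.eval n + 1) * k) :
    x ++ dpGen k (padCert (p.eval n) y) z ∈ U.upSlice R p n k t s :=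
  ⟨x, y, z, rfl, hx, hK, hy, hz⟩

/-- Only finitely many strings have `K^t`-complexity `< m` (each is the output of one of the finitely
many programs of length `< m`). (Same statement as `UniversalMachine.finite_setOf_ktAt_lt` of
`Cryptography/LiuPassCondEPPRG.lean`, which is not imported here.) [Li–Vitányi, Thm 2.2.1] [folklore] -/
theorem finite_setOf_ktAt_lt' (t m : ℕ) : {x | U.ktAt t x < m}.Finite := by
  refine ((List.finite_length_lt Bool m).biUnion fun prog _ =>
    (show ({x | U.run prog t = some x} : Set (List Bool)).Subsingleton from
      fun x hx y hy => Option.some.inj (hx.symm.trans hy)).finite).subset ?_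
  intro x hx
  obtain ⟨prog, hrun, hlen⟩ := U.exists_run_eq_of_ktAt_lt hx
  have hlen' : prog.length < m := by exact_mod_cast hlen
  exact Set.mem_biUnion (t := fun prog => {x | U.run prog t = some x}) hlen' hrun

/-- The number of strings of a fixed length. [folklore] -/
theorem ncard_setOf_length_eq (L : ℕ) : {z : List Bool | z.length = L}.ncard = 2 ^ L := by
  have h : {z : List Bool | z.length = L} = Set.range (List.Vector.toList : List.Vector Bool L → List Bool) := by
    ext z
    constructor
    · exact fun hz => ⟨⟨z, hz⟩, rfl⟩
    · rintro ⟨v, rfl⟩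
      exact v.toList_length
  rw [h, Set.ncard_range_of_injective List.Vector.toList_injective, Nat.card_eq_fintype_card, card_vector,
    Fintype.card_bool]

/-- **The slices are small**: if every `x` has at most one certificate, then
`|L'_{⟨n,k,t,s⟩}| < 2^{s+1} · 2^{(p(n)+1)k}` — each member is determined by `x` (fewer than `2^{s+1}`
strings have `K^t(x) ≤ s`, Fact 3.7) and the seed `z`. (Printed, with the hashing: `|L'| ≤
2^{s+1} · 2^{|w|+|r|} · 2^{-k+log p(n)+1}`.) [Hirahara 2021 (ECCC TR21-058), proof of Thm. 8.9 (p. 40),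
Fact 3.7] [cite: Hirahara2021, Thm. 8.9 (proof)] -/
theorem ncard_upSlice_lt {R : Language Bool} {p : Polynomial ℕ}
    (hsub : ∀ x : List Bool, (certSet R p x).Subsingleton) (n k t s : ℕ) :
    (U.upSlice R p n k t s).ncard < 2 ^ (s + 1) * 2 ^ ((p.eval n + 1) * k) := by
  classical
  set N := p.eval n + 1 with hN
  set S : Set (List Bool) := {x | U.ktAt t x < ((s + 1 : ℕ) : ℕ∞)} with hS
  set Z : Set (List Bool) := {z | z.length = N * k} with hZ
  have hSfin : S.Finite := U.finite_setOf_ktAt_lt' t (s + 1)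
  have hZfin : Z.Finite := List.finite_length_eq Bool (N * k)
  have hScard : S.ncard < 2 ^ (s + 1) := U.ncard_setOf_ktAt_lt t (s + 1)
  have hZcard : Z.ncard = 2 ^ (N * k) := ncard_setOf_length_eq _
  let f : List Bool → List Bool × List Bool := fun v => (v.take n, (v.drop n).take (N * k))
  have hproj : ∀ (x u z : List Bool), x.length = n → z.length = N * k →
      f (x ++ dpGen k u z) = (x, z) := by
    intro x u z hx hz
    simp only [f, List.take_left' hx, List.drop_left' hx]
    rw [← hz, take_length_dpGen]
  have hmaps : ∀ v ∈ U.upSlice R p n k t s, f v ∈ S ×ˢ Z := by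
    rintro v ⟨x, y, z, rfl, hx, hK, hy, hz⟩
    rw [hproj x _ z hx hz, Set.mem_prod]
    refine ⟨lt_of_le_of_lt hK ?_, hz⟩
    exact_mod_cast Nat.lt_succ_self s
  have hinj : Set.InjOn f (U.upSlice R p n k t s) := by
    rintro v ⟨x, y, z, rfl, hx, hK, hy, hz⟩ v' ⟨x', y', z', rfl, hx', hK', hy', hz'⟩ hff
    rw [hproj x _ z hx hz, hproj x' _ z' hx' hz'] at hff
    simp only [Prod.mk.injEq] at hff
    obtain ⟨rfl, rfl⟩ := hff
    rw [hsub x hy hy']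
  calc (U.upSlice R p n k t s).ncard ≤ (S ×ˢ Z).ncard :=
        Set.ncard_le_ncard_of_injOn f hmaps hinj (hSfin.prod hZfin)
    _ = S.ncard * Z.ncard := Set.ncard_prod
    _ < 2 ^ (s + 1) * 2 ^ (N * k) := by
        rw [hZcard]
        exact Nat.mul_lt_mul_of_pos_right hScard (by positivity)

/-- Logarithmic form of the size bound: `log |L'_{⟨n,k,t,s⟩}| ≤ s + (p(n)+1)k`
(`= s + |w| - k`). [Hirahara 2021 (ECCC TR21-058), proof of Thm. 8.9 (p. 41, "`log |L'| ≤
s + |w| + |r| - k + log p(n) + 2`")] [cite: Hirahara2021, Thm. 8.9 (proof)] -/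
theorem log_ncard_upSlice_le {R : Language Bool} {p : Polynomial ℕ}
    (hsub : ∀ x : List Bool, (certSet R p x).Subsingleton) (n k t s : ℕ) :
    Nat.log 2 (U.upSlice R p n k t s).ncard ≤ s + (p.eval n + 1) * k := by
  have h := U.ncard_upSlice_lt hsub n k t s
  rw [← pow_add] at h
  by_cases h0 : (U.upSlice R p n k t s).ncard = 0
  · rw [h0, Nat.log_zero_right]
    exact Nat.zero_le _
  · have := Nat.log_lt_of_lt_pow h0 h
    omega

end UniversalMachine

/-! ### The acceptance probability of the compression algorithm -/

/-- `accProb M x ι m := Pr_{w ← {0,1}^m}[(x ‖ w, 1^ι) ∈ M]` — the quantity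
`Pr_w[M(x, w; 1^{⟨n,k,t,s⟩}) = 1]` of Eq. (13), for the separating language `M` of the compression
problem. [Hirahara 2021 (ECCC TR21-058), proof of Thm. 8.9, Eq. (13)] [cite: Hirahara2021, Thm. 8.9 (proof)] -/
noncomputable def accProb (M : Set (List Bool)) (x : List Bool) (ι m : ℕ) : ℝ :=
  uniformProb m {w | paramEnc (x ++ w, ι) ∈ M}

/-- The deterministic test `D(w) := M(x, w; 1^ι)` of the proof of Claim 8.11 (no random string `r`
for `UP`). [Hirahara 2021 (ECCC TR21-058), proof of Thm. 8.9 (`D_r`)] [cite: Hirahara2021, Thm. 8.9 (proof)] -/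
noncomputable def sepTest (M : Set (List Bool)) (x : List Bool) (ι : ℕ) : List Bool → Bool :=
  fun w => M.boolIndicator (paramEnc (x ++ w, ι))

/-- The test accepts `w` iff `(x ‖ w, 1^ι) ∈ M`. [folklore] -/
@[simp] theorem sepTest_eq_true_iff (M : Set (List Bool)) (x : List Bool) (ι : ℕ) (w : List Bool) :
    sepTest M x ι w = true ↔ paramEnc (x ++ w, ι) ∈ M := by
  unfold sepTest
  exact (Set.mem_iff_boolIndicator _ _).symm

namespace UniversalMachine

variable (U : UniversalMachine)

/-! ### The toolkit: the five ingredients of the proof of Thm. 8.9, for `UP` -/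

/-- **The data and guarantees used by the proof of Thm. 8.9** for a `UP`-type verifier `(R, p)`
and a universal machine `U` — the objects delivered by the five cited ingredients, with exactly
the properties the proof uses:

* `c₀, a₀, kt_le` — cheap printing: `K^t(x) ≤ |x| + a₀` for `t ≥ c₀` (`exists_ktAt_le_length_add`);
* `τ, sK, sK_ge, sK_le` — **Lemma 5.1 with Fact 3.8**: a polynomial `τ` and an approximation
  `s = sK(x, t)` with `K^{τ(|x|+t)}(x) ≤ s ≤ K^t(x) + log τ(|x|+t)` (Eq. (12), `p_K(t) := τ(|x|+t)`);
* `pc, M, yes_mem, no_not_mem` — **Thm. 4.2** applied to the ensemble `L'` (`upSlice`): a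
  polynomial `p♯ = pc` and a language `M` (the separator of the compression promise problem)
  containing every `(v, 1^ι)` with `v ∈ L'_ι` and no `(v, 1^ι)` with
  `K^{pc(ι)}(v) > log |L'_ι| + log pc(ι)`;
* `Tst, tst_complete, tst_sound` — **Lemma 3.4** (`pr-BPP = pr-P`) applied to the estimation of
  `Pr_w[M(x, w; 1^{ι}) = 1]` (Eq. (13)): a deterministic test accepting whenever this probability is
  `≤ 1/32` and only if it is `< 2/3` (the paper's `δ = 1/24`, `2δ`, `3δ`; any constants with this
  shape do, no Markov step being needed without the random string `r`);
* `enum, enum_spec` — **Thm. 3.12** (enumeration form) for the tests `w ↦ M(x, w; 1^ι)`: a list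
  `enum x ι k` containing every `u ∈ {0,1}^{p(|x|)+1}` such that the test `1/3`-distinguishes
  `DP_k(u; ·)` from uniform;
* `p₀, pw, soi` — **Thm. 5.2** (weak symmetry of information), failure form with `ε = 1/e`.

Polynomial-time computability of `sK`, `M`, `Tst`, `enum` is not part of the toolkit (it is
supplied separately when the scheme is shown to be polynomial-time); this structure carries the
*correctness* analysis (Claims 8.10 and 8.11). [Hirahara 2021 (ECCC TR21-058), proof of Thm. 8.9,
Eq. (12)–(13), Claims 8.10–8.11] [cite: Hirahara2021, Thm. 8.9 (proof)] -/
structure UPToolkit (R : Language Bool) (p : Polynomial ℕ) where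
  /-- Budget from which printing programs exist. -/
  c₀ : ℕ
  /-- Additive overhead of printing programs. -/
  a₀ : ℕ
  /-- `K^t(x) ≤ |x| + a₀` for `t ≥ c₀`. [`exists_ktAt_le_length_add`] -/
  kt_le : ∀ (x : List Bool) (t : ℕ), c₀ ≤ t → U.ktAt t x ≤ x.length + a₀
  /-- The polynomial of `Gap_τ(K vs K) ∈ pr-P` (Lemma 5.1). -/
  τ : Polynomial ℕ
  /-- The approximation `s(x, t)` of `K^t(x)` (Fact 3.8 from Lemma 5.1). -/
  sK : List Bool → ℕ → ℕ
  /-- Eq. (12), lower part: `K^{τ(|x|+t)}(x) ≤ s`. [Fact 3.8] -/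
  sK_ge : ∀ (x : List Bool) (t : ℕ), c₀ ≤ t → U.ktAt (τ.eval (x.length + t)) x ≤ sK x t
  /-- Eq. (12), upper part: `s ≤ K^t(x) + log τ(|x|+t)`. [Fact 3.8] -/
  sK_le : ∀ (x : List Bool) (t : ℕ), c₀ ≤ t →
    (sK x t : ℕ∞) ≤ U.ktAt t x + Nat.log 2 (τ.eval (x.length + t))
  /-- The polynomial `p♯` of Thm. 4.2 for the ensemble `L'`. -/
  pc : Polynomial ℕ
  /-- The separating language `M` of the compression promise problem of `L'` (Thm. 4.2). -/
  M : Set (List Bool)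
  /-- `M` accepts the yes-instances `(v, 1^ι)`, `v ∈ L'_ι`. [Thm. 4.2] -/
  yes_mem : ∀ (n k t s : ℕ) (v : List Bool), v ∈ U.upSlice R p n k t s → paramEnc (v, idx4 n k t s) ∈ M
  /-- `M` rejects the no-instances: `K^{pc(ι)}(v) > log |L'_ι| + log pc(ι)`. [Thm. 4.2] -/
  no_not_mem : ∀ (n k t s : ℕ) (v : List Bool),
    ((Nat.log 2 (U.upSlice R p n k t s).ncard + Nat.log 2 (pc.eval (idx4 n k t s)) : ℕ) : ℕ∞) <
      U.ktAt (pc.eval (idx4 n k t s)) v → paramEnc (v, idx4 n k t s) ∉ M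
  /-- The derandomised estimator `Tst x ι m` of `Pr_{w ← {0,1}^m}[M(x, w; 1^ι) = 1]` (Eq. (13),
  Lemma 3.4): it is given `x`, the index `ι` and the sample length `m`. -/
  Tst : List Bool → ℕ → ℕ → Bool
  /-- Completeness of the estimator: probability `≤ 1/32` ⟹ accept. [Lemma 3.4, Eq. (13)] -/
  tst_complete : ∀ (x : List Bool) (ι m : ℕ), accProb M x ι m ≤ 1 / 32 → Tst x ι m = true
  /-- Soundness of the estimator: accept ⟹ probability `< 2/3`. [Lemma 3.4, Eq. (13)] -/
  tst_sound : ∀ (x : List Bool) (ι m : ℕ), Tst x ι m = true → accProb M x ι m < 2 / 3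
  /-- The enumerator of Thm. 3.12 for the tests `w ↦ M(x, w; 1^ι)` and advantage `1/3`. -/
  enum : List Bool → ℕ → ℕ → List (List Bool)
  /-- The list contains every `u` of length `p(|x|)+1` whose `DP_k` is `1/3`-distinguished. [Thm. 3.12] -/
  enum_spec : ∀ (x : List Bool) (ι k : ℕ) (u : List Bool), u.length = p.eval x.length + 1 →
    (1 / 3 : ℝ) ≤ dpAdvantage k u (sepTest M x ι) → u ∈ enum x ι k
  /-- The threshold polynomial `p₀` of Thm. 5.2. -/
  p₀ : Polynomial ℕ
  /-- The loss polynomial `p_w` of Thm. 5.2. -/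
  pw : Polynomial ℕ
  /-- Thm. 5.2, failure form with `ε = 1/e`: for `|x| = n`, `t ≥ p₀(nm)`, `e ≥ 1`,
  `Pr_w[K^t(xw) + log p_w(te) < K^{p_w(te)}(x) + m] ≤ 1/e`. [Thm. 5.2] -/
  soi : ∀ (n m t e : ℕ) (x : List Bool), x.length = n → p₀.eval (n * m) ≤ t → 1 ≤ e →
    uniformProb m {w | U.ktAt t (x ++ w) + Nat.log 2 (pw.eval (t * e)) < U.ktAt (pw.eval (t * e)) x + m} ≤
      1 / (e : ℝ)

namespace UPToolkit

variable {U} {R : Language Bool} {p : Polynomial ℕ} (K : U.UPToolkit R p)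

/-! ### The scheme: parameters, checker and solver -/

/-- `t' := τ(n + t)` (the paper's `t' = p_K(t)`). [Hirahara 2021 (ECCC TR21-058), proof of Thm. 8.9]
[cite: Hirahara2021, Thm. 8.9 (proof)] -/
def tP (n t : ℕ) : ℕ := K.τ.eval (n + t)

/-- The slack `Λ(t) := c · (log (t+2) + 1)` added to `k` (the paper's
`k' - k = log p*(t') + log p_K(t) + log p_w(t'') + 1 = O(log t)`), for a constant `c` fixed by the
analysis. [Hirahara 2021 (ECCC TR21-058), proof of Claim 8.10 (choice of `k'`)]
[cite: Hirahara2021, Claim 8.10 (proof)] -/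
def lam (c t : ℕ) : ℕ := c * (Nat.log 2 (t + 2) + 1)

/-- `k' := k + Λ(t)`. [Hirahara 2021 (ECCC TR21-058), proof of Claim 8.10] [cite: Hirahara2021, Claim 8.10 (proof)] -/
def kP (c t k : ℕ) : ℕ := k + lam c t

/-- The index `ι' := ⟨n, k', t', s⟩` at which the compression algorithm is queried.
[Hirahara 2021 (ECCC TR21-058), proof of Thm. 8.9 (the checker `C`)] [cite: Hirahara2021, Thm. 8.9 (proof)] -/
def idxP (c : ℕ) (x : List Bool) (t k : ℕ) : ℕ :=
  idx4 x.length (kP c t k) (K.tP x.length t) (K.sK x t)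

/-- **The checker** `C₀(x; 1ᵗ, 1ᵏ)` (before capping `k`): accept iff the derandomised estimate of
`Pr_w[M(x, w; 1^{ι'}) = 1]` is small. [Hirahara 2021 (ECCC TR21-058), proof of Thm. 8.9 (the
checker `C`)] [cite: Hirahara2021, Thm. 8.9 (proof)] -/
def checkerCore (c : ℕ) (x : List Bool) (t k : ℕ) : Bool :=
  K.Tst x (K.idxP c x t k) ((p.eval x.length + 1) * kP c t k + kP c t k)

variable (R p) in
/-- The certificate test of the solver: `u ↦ V(x, unpad u)`. [Hirahara 2021 (ECCC TR21-058), proof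
of Thm. 8.9 (the solver `S`: "If there exists some `y ∈ Y_r` such that `V(x, y) = 1`")]
[cite: Hirahara2021, Thm. 8.9 (proof)] -/
noncomputable def isGood (x u : List Bool) : Bool :=
  decide ((unpadCert u).length ≤ p.eval x.length) && R.boolIndicator (boolPair x (unpadCert u))

/-- **The solver** `S₀(x; 1ᵗ, k)` (before capping; `k` is read off the unary `2^k`): enumerate the
candidates of Thm. 3.12 for the test `w ↦ M(x, w; 1^{ι'})` and output the first one that unpads to
a certificate of `x` (the empty string if none). [Hirahara 2021 (ECCC TR21-058), proof of Thm. 8.9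
(the solver `S`)] [cite: Hirahara2021, Thm. 8.9 (proof)] -/
noncomputable def solverCore (c : ℕ) (x : List Bool) (t k : ℕ) : List Bool :=
  ((K.enum x (K.idxP c x t k) (kP c t k)).find? (isGood R p x)).elim [] unpadCert

variable (p) in
/-- `m' := |w| = (p(n)+1)k' + k'`, the length of `DP_{k'}(ỹ; z)`. [Hirahara 2021 (ECCC TR21-058),
proof of Thm. 8.9 (`|w| = d + k`)] [cite: Hirahara2021, Thm. 8.9 (proof)] -/
def mP (c : ℕ) (x : List Bool) (t k : ℕ) : ℕ :=
  (p.eval x.length + 1) * kP c t k + kP c t k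

/-- The time bound `T := p♯(ι') + p₀(n·m')` at which weak symmetry of information is invoked in the
proof of Claim 8.10 (the paper's `t'' := p*(t')`, enlarged so that Thm. 5.2 applies; analysis only,
not computed by the scheme). [Hirahara 2021 (ECCC TR21-058), proof of Claim 8.10]
[cite: Hirahara2021, Claim 8.10 (proof)] -/
def TT (c : ℕ) (x : List Bool) (t k : ℕ) : ℕ :=
  K.pc.eval (K.idxP c x t k) + K.p₀.eval (x.length * mP p c x t k)

/-! ### Unfolding lemmas -/

/-- The queried index is `⟨n, k', t', s⟩`. [folklore] -/
theorem idxP_eq (c : ℕ) (x : List Bool) (t k : ℕ) :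
    K.idxP c x t k = idx4 x.length (kP c t k) (K.tP x.length t) (K.sK x t) := rfl

/-- A good candidate unpads to a certificate. [folklore] -/
theorem isGood_eq_true_iff (x u : List Bool) :
    isGood R p x u = true ↔ unpadCert u ∈ certSet R p x := by
  simp only [isGood, Bool.and_eq_true, decide_eq_true_eq, certSet, Set.mem_setOf_eq]
  rw [← Set.mem_iff_boolIndicator]
  exact Iff.rfl

/-! ### Claim 8.11: if the checker accepts and `x` has a certificate, the solver finds one -/

/-- **Claim 8.11 (for `UP`).** If `C₀(x; 1ᵗ, 1ᵏ) = 1`, `t ≥ c₀` and `x` has a certificate `y`, then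
`S₀(x; 1ᵗ, k)` outputs a certificate of `x`. Printed argument, without the random string `r`:
acceptance means (soundness of the estimator, Eq. (13)) `Pr_w[D(w) = 1] < 2/3` for the test
`D(w) := M(x, w; 1^{ι'})`; on the other hand `(x ‖ DP_{k'}(ỹ; z)) ∈ L'_{ι'}` for every seed `z`
(because `K^{t'}(x) ≤ s`, Eq. (12)), so `D(DP_{k'}(ỹ; z)) = 1` always; hence `D` `1/3`-distinguishes
`DP_{k'}(ỹ; ·)` from uniform, the padded certificate `ỹ` is in the list of Thm. 3.12, and the first
good candidate of the list is a certificate. [Hirahara 2021 (ECCC TR21-058), Claim 8.11]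
[cite: Hirahara2021, Claim 8.11] -/
theorem solverCore_mem_certSet (c : ℕ) {x : List Bool} {t k : ℕ} (ht : K.c₀ ≤ t)
    (hacc : K.checkerCore c x t k = true) (hx : ∃ y, y ∈ certSet R p x) :
    K.solverCore c x t k ∈ certSet R p x := by
  obtain ⟨y, hy⟩ := hx
  set n := x.length with hn
  set k' := kP c t k with hk'
  set ι' := K.idxP c x t k with hι'
  -- soundness of the estimator
  have hP : accProb K.M x ι' ((p.eval n + 1) * k' + k') < 2 / 3 := K.tst_sound x ι' _ hacc
  -- the test accepts every output of `DP_{k'}(ỹ; ·)`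
  set u := padCert (p.eval n) y with hu
  have hulen : u.length = p.eval n + 1 := length_padCert hy.1
  have h1 : uniformProb (u.length * k') {z | sepTest K.M x ι' (dpGen k' u z) = true} = 1 := by
    refine uniformProb_eq_one_of_forall fun z hz => ?_
    rw [Set.mem_setOf_eq, sepTest_eq_true_iff]
    exact K.yes_mem n k' (K.tP n t) (K.sK x t) _
      (append_dpGen_mem_upSlice rfl (K.sK_ge x t ht) hy (by rw [hz, hulen]))
  have h2 : uniformProb (u.length * k' + k') {w | sepTest K.M x ι' w = true} ≤ 1 - 1 / 3 := by
    have hset : {w | sepTest K.M x ι' w = true} = {w | paramEnc (x ++ w, ι') ∈ K.M} := by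
      ext w
      exact sepTest_eq_true_iff _ _ _ _
    rw [hset, hulen]
    have hP' : accProb K.M x ι' ((p.eval n + 1) * k' + k') ≤ 1 - 1 / 3 := by linarith
    exact hP'
  have hadv : (1 / 3 : ℝ) ≤ dpAdvantage k' u (sepTest K.M x ι') :=
    le_dpAdvantage_of_le_of_le (q := 1) (by rw [h1]) h2
  have hmem : u ∈ K.enum x ι' k' := K.enum_spec x ι' k' u (by rw [hulen]) hadv
  -- the search succeeds
  have hgood : isGood R p x u = true := by
    rw [isGood_eq_true_iff, hu, unpadCert_padCert]
    exact hy
  obtain ⟨u', hu'⟩ : ∃ u', (K.enum x ι' k').find? (isGood R p x) = some u' := by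
    cases hfind : (K.enum x ι' k').find? (isGood R p x) with
    | none => exact absurd hgood (by simpa using List.find?_eq_none.1 hfind u hmem)
    | some u' => exact ⟨u', rfl⟩
  have hg' : isGood R p x u' = true := List.find?_some hu'
  rw [isGood_eq_true_iff] at hg'
  have : K.solverCore c x t k = unpadCert u' := by
    simp only [solverCore, ← hι', ← hk', hu', Option.elim_some]
  rw [this]
  exact hg'


/-! ### Claim 8.10: small depth forces acceptance -/

/-- **The heart of Claim 8.10 (for `UP`).** Fix `x` (length `n`), `t ≥ c₀`, `k`, a budget `q` with
`cd^{t,q}(x) ≤ k` and `q ≥ p_w(32T)`, and assume the slack `Λ(t)` dominates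
`log t' + log p_w(32T) + log p♯(ι') + 2`. Then every `w ∈ {0,1}^{m'}` satisfying the conclusion of
weak symmetry of information at time `T`, `K^T(xw) ≥ K^{p_w(32T)}(x) + m' - log p_w(32T)`, gives a
**no-instance** `(xw, 1^{ι'})` of the compression problem: `K^{p♯(ι')}(xw) > log |L'_{ι'}| + log p♯(ι')`.
Printed chain: `K^{t''}(x,w) ≥ K^t(x) - cd^{t,q(t)}(x) + |w| - log p_w ≥ s - log p_K(t) - k + |w| -
log p_w > s + |w| - k' + log p*` by the choice of `k'`, and `log |L'| ≤ s + |w| - k' + 1`.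
[Hirahara 2021 (ECCC TR21-058), Claim 8.10 (proof)] [cite: Hirahara2021, Claim 8.10 (proof)] -/
theorem noInstance_of_soi (hsub : ∀ x : List Bool, (certSet R p x).Subsingleton) (c : ℕ)
    {x : List Bool} {t k q : ℕ} (w : List Bool) (ht : K.c₀ ≤ t) (hcd : U.cdAt t q x ≤ k)
    (hq : K.pw.eval (K.TT c x t k * 32) ≤ q)
    (hlam : Nat.log 2 (K.tP x.length t) + Nat.log 2 (K.pw.eval (K.TT c x t k * 32)) +
      Nat.log 2 (K.pc.eval (K.idxP c x t k)) + 2 ≤ lam c t)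
    (hok : U.ktAt (K.pw.eval (K.TT c x t k * 32)) x + mP p c x t k ≤
      U.ktAt (K.TT c x t k) (x ++ w) + Nat.log 2 (K.pw.eval (K.TT c x t k * 32))) :
    ((Nat.log 2 (U.upSlice R p x.length (kP c t k) (K.tP x.length t) (K.sK x t)).ncard +
        Nat.log 2 (K.pc.eval (K.idxP c x t k)) : ℕ) : ℕ∞) <
      U.ktAt (K.pc.eval (K.idxP c x t k)) (x ++ w) := by
  set n := x.length with hn
  set k' := kP c t k with hk'
  set t' := K.tP n t with ht'
  set s := K.sK x t with hsdef
  set ι' := K.idxP c x t k with hι'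
  set m' := mP p c x t k with hm'
  set T := K.TT c x t k with hT
  set lpw := Nat.log 2 (K.pw.eval (T * 32)) with hlpw
  set lsl := Nat.log 2 (U.upSlice R p n k' t' s).ncard with hlsl
  set lpc := Nat.log 2 (K.pc.eval ι') with hlpc
  set P := (p.eval n + 1) * k' with hP
  have hsl : lsl ≤ s + P := U.log_ncard_upSlice_le hsub n k' t' s
  have hm'eq : m' = P + k' := rfl
  have hk'eq : k' = k + lam c t := rfl
  -- `K^t(x)` is finite
  have hA := K.kt_le x t ht
  have hAne : U.ktAt t x ≠ ⊤ := ne_top_of_le_ne_top (ENat.coe_ne_top _) hA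
  obtain ⟨A, hAeq⟩ : ∃ A : ℕ, U.ktAt t x = A := ⟨(U.ktAt t x).toNat, (ENat.coe_toNat hAne).symm⟩
  have hs : (s : ℕ∞) ≤ U.ktAt t x + Nat.log 2 t' := K.sK_le x t ht
  have hcd' : U.ktAt t x ≤ k + U.ktAt (K.pw.eval (T * 32)) x :=
    ((U.cdAt_le_iff).1 hcd).trans (add_le_add (le_refl (k : ℕ∞)) (U.ktAt_anti hq x))
  have hTpc : U.ktAt T (x ++ w) ≤ U.ktAt (K.pc.eval ι') (x ++ w) := U.ktAt_anti (Nat.le_add_right _ _) _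
  -- case on `K^T(xw)`
  rcases eq_or_ne (U.ktAt T (x ++ w)) ⊤ with htop | hne
  · -- `K^T(xw) = ⊤`, hence `K^{p♯(ι')}(xw) = ⊤`
    rw [htop, top_le_iff] at hTpc
    rw [hTpc]
    exact ENat.coe_lt_top _
  · obtain ⟨D, hDeq⟩ : ∃ D : ℕ, U.ktAt T (x ++ w) = D := ⟨(U.ktAt T (x ++ w)).toNat, (ENat.coe_toNat hne).symm⟩
    -- `K^{p_w(32T)}(x)` is finite as well
    have hCfin : U.ktAt (K.pw.eval (T * 32)) x ≠ ⊤ := by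
      intro hC
      rw [hC, top_add, hDeq, top_le_iff] at hok
      exact absurd hok (ENat.coe_ne_top _)
    obtain ⟨Cw, hCeq⟩ : ∃ Cw : ℕ, U.ktAt (K.pw.eval (T * 32)) x = Cw :=
      ⟨(U.ktAt (K.pw.eval (T * 32)) x).toNat, (ENat.coe_toNat hCfin).symm⟩
    rw [hAeq, hCeq] at hcd'
    rw [hAeq] at hs
    rw [hCeq, hDeq] at hok
    have h1 : A ≤ k + Cw := by exact_mod_cast hcd'
    have h2 : s ≤ A + Nat.log 2 t' := by exact_mod_cast hs
    have h3 : Cw + m' ≤ D + lpw := by exact_mod_cast hok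
    refine lt_of_lt_of_le ?_ hTpc
    rw [hDeq]
    have h4 : lsl + lpc < D := by omega
    exact_mod_cast h4

/-- **Claim 8.10 (for `UP`).** Under the hypotheses of `noInstance_of_soi` (small depth
`cd^{t,q}(x) ≤ k`, `q ≥ p_w(32T)`, large slack), the checker accepts: the compression algorithm `M`
rejects no-instances, so `Pr_w[M(x, w; 1^{ι'}) = 1] ≤ Pr_w[(xw, 1^{ι'}) ∉ Π_No] ≤ Pr_w[¬ SoI] ≤ 1/32`
by Thm. 5.2 (at time `T ≥ p₀(n m')`, `ε = 1/32`), and the estimator accepts (completeness, Eq. (13)).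
[Hirahara 2021 (ECCC TR21-058), Claim 8.10] [cite: Hirahara2021, Claim 8.10] -/
theorem checkerCore_eq_true (hsub : ∀ x : List Bool, (certSet R p x).Subsingleton) (c : ℕ)
    {x : List Bool} {t k q : ℕ} (ht : K.c₀ ≤ t) (hcd : U.cdAt t q x ≤ k)
    (hq : K.pw.eval (K.TT c x t k * 32) ≤ q)
    (hlam : Nat.log 2 (K.tP x.length t) + Nat.log 2 (K.pw.eval (K.TT c x t k * 32)) +
      Nat.log 2 (K.pc.eval (K.idxP c x t k)) + 2 ≤ lam c t) :
    K.checkerCore c x t k = true := by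
  set n := x.length with hn
  set k' := kP c t k with hk'
  set m' := mP p c x t k with hm'
  set T := K.TT c x t k with hT
  refine K.tst_complete x (K.idxP c x t k) _ ?_
  have hsoi := K.soi n m' T 32 x rfl (Nat.le_add_left _ _) (by norm_num)
  calc accProb K.M x (K.idxP c x t k) ((p.eval n + 1) * k' + k')
        = uniformProb m' {w | paramEnc (x ++ w, K.idxP c x t k) ∈ K.M} := rfl
    _ ≤ uniformProb m'
          {w | U.ktAt T (x ++ w) + Nat.log 2 (K.pw.eval (T * 32)) < U.ktAt (K.pw.eval (T * 32)) x + m'} := by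
        refine uniformProb_mono' fun w hw => ?_
        rw [Set.mem_setOf_eq] at hw ⊢
        by_contra hok
        exact K.no_not_mem n k' (K.tP n t) (K.sK x t) (x ++ w)
          (K.noInstance_of_soi hsub c w ht hcd hq hlam (not_lt.1 hok)) hw
    _ ≤ 1 / 32 := by simpa using hsoi

/-! ### Polynomial bounds on the parameters -/

/-- Monotonicity of `ℕ`-polynomial evaluation (private copy). [folklore] -/
private theorem natPoly_eval_mono (q : Polynomial ℕ) {a b : ℕ} (h : a ≤ b) : q.eval a ≤ q.eval b := by
  rw [Polynomial.eval_eq_sum_range, Polynomial.eval_eq_sum_range]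
  exact Finset.sum_le_sum fun i _ => Nat.mul_le_mul_left _ (Nat.pow_le_pow_left h i)

open AlgebraicComplexity in
/-- A polynomial is p-bounded. [folklore] -/
private theorem isPBounded_eval (q : Polynomial ℕ) : IsPBounded fun n => q.eval n :=
  (isPBounded_iff_exists_polynomial_holds _).2 ⟨q, fun _ => le_rfl⟩

open AlgebraicComplexity in
/-- A polynomial of a p-bounded function is p-bounded. [folklore] -/
private theorem isPBounded_eval_comp (q : Polynomial ℕ) {f : ℕ → ℕ} (hf : IsPBounded f) :
    IsPBounded fun n => q.eval (f n) :=
  IsPBounded.comp_holds (isPBounded_eval q) hf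

/-- Upper bound `τ(2t)` for `t' = τ(n+t)` (when `n ≤ t`). [folklore] -/
def F1 (t : ℕ) : ℕ := K.τ.eval (2 * t)

/-- Upper bound for `s = sK(x, t)` (when `n ≤ t`, `t ≥ c₀`). [folklore] -/
def F2 (t : ℕ) : ℕ := t + K.a₀ + K.F1 t

/-- Upper bound for `k'` (when `k ≤ n + a₀`, `n ≤ t`, `Λ(t) ≤ t`). [folklore] -/
def F3 (t : ℕ) : ℕ := 2 * t + K.a₀

/-- Upper bound for the queried index `ι'`. [folklore] -/
def IB (t : ℕ) : ℕ := idx4 t (K.F3 t) (K.F1 t) (K.F2 t)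

/-- Upper bound for `p♯(ι')`. [folklore] -/
def PC (t : ℕ) : ℕ := K.pc.eval (K.IB t)

/-- Upper bound for `m'`. [folklore] -/
def MB (t : ℕ) : ℕ := (p.eval t + 1) * K.F3 t + K.F3 t

/-- Upper bound for `T`. [folklore] -/
def TB (t : ℕ) : ℕ := K.PC t + K.p₀.eval (t * K.MB t)

/-- Upper bound for `p_w(32T)`. [folklore] -/
def PW (t : ℕ) : ℕ := K.pw.eval (K.TB t * 32)

/-- The quantity whose logarithm the slack `Λ(t)` must dominate: `4 (τ(2t)+1) (PW(t)+1) (PC(t)+1)`. [folklore] -/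
def BIG (t : ℕ) : ℕ := 4 * ((K.F1 t + 1) * ((K.PW t + 1) * (K.PC t + 1)))

open AlgebraicComplexity in
/-- All the bounds are polynomially bounded. [folklore] -/
theorem isPBounded_PW_BIG : IsPBounded K.PW ∧ IsPBounded K.BIG := by
  have hid : IsPBounded (fun t : ℕ => t) := IsPBounded.id
  have hF1 : IsPBounded K.F1 :=
    isPBounded_eval_comp K.τ (IsPBounded.mul_holds (IsPBounded.const 2) hid)
  have hF2 : IsPBounded K.F2 :=
    IsPBounded.add_holds (IsPBounded.add_holds hid (IsPBounded.const _)) hF1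
  have hF3 : IsPBounded K.F3 :=
    IsPBounded.add_holds (IsPBounded.mul_holds (IsPBounded.const 2) hid) (IsPBounded.const _)
  have hpair : ∀ {f g : ℕ → ℕ}, IsPBounded f → IsPBounded g → IsPBounded fun t => Nat.pair (f t) (g t) :=
    fun hf hg => (IsPBounded.pow_holds (IsPBounded.add_holds (IsPBounded.add_holds hf hg)
      (IsPBounded.const 1)) 2).mono fun t => pair_le_sq _ _
  have hIB : IsPBounded K.IB := hpair hid (hpair hF3 (hpair hF1 hF2))
  have hPC : IsPBounded K.PC := isPBounded_eval_comp K.pc hIB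
  have hMB : IsPBounded K.MB :=
    IsPBounded.add_holds (IsPBounded.mul_holds (IsPBounded.add_holds (isPBounded_eval p)
      (IsPBounded.const 1)) hF3) hF3
  have hTB : IsPBounded K.TB :=
    IsPBounded.add_holds hPC (isPBounded_eval_comp K.p₀ (IsPBounded.mul_holds hid hMB))
  have hPW : IsPBounded K.PW :=
    isPBounded_eval_comp K.pw (IsPBounded.mul_holds hTB (IsPBounded.const 32))
  refine ⟨hPW, ?_⟩
  exact IsPBounded.mul_holds (IsPBounded.const 4) (IsPBounded.mul_holds
    (IsPBounded.add_holds hF1 (IsPBounded.const 1)) (IsPBounded.mul_holds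
      (IsPBounded.add_holds hPW (IsPBounded.const 1)) (IsPBounded.add_holds hPC (IsPBounded.const 1))))

/-- **Domination of the actual parameters by the bounds**, for `n ≤ t`, `t ≥ c₀`, `k ≤ n + a₀` and
`Λ(t) ≤ t`. [Hirahara 2021 (ECCC TR21-058), proof of Thm. 8.9, footnote 24 ("so that `t` is the
largest parameter and the bound `p*(t)` depends only on `t`")] [cite: Hirahara2021, Thm. 8.9 (proof)] -/
theorem params_le (c : ℕ) {x : List Bool} {t k : ℕ} (hn : x.length ≤ t) (ht : K.c₀ ≤ t)
    (hk : k ≤ x.length + K.a₀) (hl : lam c t ≤ t) :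
    K.tP x.length t ≤ K.F1 t ∧ K.pw.eval (K.TT c x t k * 32) ≤ K.PW t ∧
      K.pc.eval (K.idxP c x t k) ≤ K.PC t := by
  set n := x.length with hn'
  have h1 : K.tP n t ≤ K.F1 t := natPoly_eval_mono K.τ (by omega)
  -- `s ≤ n + a₀ + log t' ≤ F2 t`
  have hA := K.kt_le x t ht
  have hAne : U.ktAt t x ≠ ⊤ := ne_top_of_le_ne_top (ENat.coe_ne_top _) hA
  obtain ⟨A, hAeq⟩ : ∃ A : ℕ, U.ktAt t x = A := ⟨(U.ktAt t x).toNat, (ENat.coe_toNat hAne).symm⟩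
  have hs := K.sK_le x t ht
  rw [hAeq] at hA hs
  have hA' : A ≤ n + K.a₀ := by exact_mod_cast hA
  have hs' : K.sK x t ≤ A + Nat.log 2 (K.tP n t) := by exact_mod_cast hs
  have hlog : Nat.log 2 (K.tP n t) ≤ K.F1 t := (Nat.log_le_self 2 _).trans h1
  have h2 : K.sK x t ≤ K.F2 t := by unfold F2; omega
  have h3 : kP c t k ≤ K.F3 t := by unfold kP F3; omega
  have h4 : K.idxP c x t k ≤ K.IB t := idx4_mono hn h3 h1 h2
  have h5 : K.pc.eval (K.idxP c x t k) ≤ K.PC t := natPoly_eval_mono K.pc h4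
  have h6 : mP p c x t k ≤ K.MB t := by
    unfold mP MB
    exact Nat.add_le_add (Nat.mul_le_mul (Nat.add_le_add_right (natPoly_eval_mono p hn) 1) h3) h3
  have h7 : K.TT c x t k ≤ K.TB t := by
    unfold TT TB
    exact Nat.add_le_add h5 (natPoly_eval_mono K.p₀ (Nat.mul_le_mul hn h6))
  have h8 : K.pw.eval (K.TT c x t k * 32) ≤ K.PW t := natPoly_eval_mono K.pw (Nat.mul_le_mul_right 32 h7)
  exact ⟨h1, h8, h5⟩

/-- `log a + log b ≤ log (ab)` for the binary logarithm (`a, b ≥ 1`). [folklore] -/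
private theorem log_add_log_le {a b : ℕ} (ha : a ≠ 0) (hb : b ≠ 0) :
    Nat.log 2 a + Nat.log 2 b ≤ Nat.log 2 (a * b) := by
  refine Nat.le_log_of_pow_le one_lt_two ?_
  rw [pow_add]
  exact Nat.mul_le_mul (Nat.pow_log_le_self 2 ha) (Nat.pow_log_le_self 2 hb)

/-- The sum of the three logarithms `+ 2` is dominated by `log BIG(t)`. [folklore] -/
theorem log_sum_le_log_BIG (c : ℕ) {x : List Bool} {t k : ℕ} (hn : x.length ≤ t) (ht : K.c₀ ≤ t)
    (hk : k ≤ x.length + K.a₀) (hl : lam c t ≤ t) :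
    Nat.log 2 (K.tP x.length t) + Nat.log 2 (K.pw.eval (K.TT c x t k * 32)) +
      Nat.log 2 (K.pc.eval (K.idxP c x t k)) + 2 ≤ Nat.log 2 (K.BIG t) := by
  obtain ⟨h1, h8, h5⟩ := K.params_le c hn ht hk hl
  have e1 : Nat.log 2 (K.tP x.length t) ≤ Nat.log 2 (K.F1 t + 1) := Nat.log_mono_right (by omega)
  have e2 : Nat.log 2 (K.pw.eval (K.TT c x t k * 32)) ≤ Nat.log 2 (K.PW t + 1) :=
    Nat.log_mono_right (by omega)
  have e3 : Nat.log 2 (K.pc.eval (K.idxP c x t k)) ≤ Nat.log 2 (K.PC t + 1) := Nat.log_mono_right (by omega)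
  have hprod : Nat.log 2 (K.F1 t + 1) + Nat.log 2 (K.PW t + 1) + Nat.log 2 (K.PC t + 1) ≤
      Nat.log 2 ((K.F1 t + 1) * ((K.PW t + 1) * (K.PC t + 1))) := by
    have := log_add_log_le (a := K.PW t + 1) (b := K.PC t + 1) (by omega) (by omega)
    have := log_add_log_le (a := K.F1 t + 1) (b := (K.PW t + 1) * (K.PC t + 1)) (by omega)
      (Nat.mul_ne_zero (by omega) (by omega))
    omega
  have hfour : Nat.log 2 (K.BIG t) = Nat.log 2 ((K.F1 t + 1) * ((K.PW t + 1) * (K.PC t + 1))) + 2 := by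
    have hne : (K.F1 t + 1) * ((K.PW t + 1) * (K.PC t + 1)) ≠ 0 :=
      Nat.mul_ne_zero (by omega) (Nat.mul_ne_zero (by omega) (by omega))
    unfold BIG
    rw [show 4 * ((K.F1 t + 1) * ((K.PW t + 1) * (K.PC t + 1))) =
        (K.F1 t + 1) * ((K.PW t + 1) * (K.PC t + 1)) * 2 * 2 by ring,
      Nat.log_mul_base one_lt_two (Nat.mul_ne_zero hne two_ne_zero),
      Nat.log_mul_base one_lt_two hne]
  omega

/-! ### Choice of the slack constant `c` and of the scheme polynomial `q` -/

/-- `c (u + 1) + 2 ≤ 2^u` for `u ≥ 2c + 4`. [folklore] -/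
private theorem mul_succ_add_two_le_two_pow (c : ℕ) : ∀ u : ℕ, 2 * c + 4 ≤ u → c * (u + 1) + 2 ≤ 2 ^ u := by
  refine Nat.le_induction ?_ fun u _ ih => ?_
  · have hc : c < 2 ^ c := Nat.lt_two_pow_self
    have hsq : c * c < 2 ^ c * 2 ^ c := Nat.mul_lt_mul'' hc hc
    have h4 : (4 : ℕ) ^ c = 2 ^ c * 2 ^ c := by
      rw [show (4 : ℕ) = 2 * 2 by norm_num, mul_pow]
    have : 2 ^ (2 * c + 4) = 16 * 4 ^ c := by
      rw [pow_add, pow_mul]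
      norm_num
      ring
    rw [this, h4]
    nlinarith [Nat.one_le_two_pow (n := c)]
  · rw [pow_succ]
    nlinarith

/-- **The slack is eventually at most `t`**: `Λ(t) = c (log (t+2) + 1) ≤ t` as soon as
`t + 2 ≥ 2^{2c+4}`. [folklore] -/
theorem lam_le_self {c t : ℕ} (h : 2 ^ (2 * c + 4) ≤ t + 2) : lam c t ≤ t := by
  unfold lam
  set u := Nat.log 2 (t + 2) with hu
  have hu1 : 2 * c + 4 ≤ u := Nat.le_log_of_pow_le one_lt_two h
  have hu2 : 2 ^ u ≤ t + 2 := Nat.pow_log_le_self 2 (by omega)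
  have := mul_succ_add_two_le_two_pow c u hu1
  omega

/-- **Choice of the slack constant.** There is `c` with `log BIG(t) + 1 ≤ Λ(t) = c (log (t+2) + 1)`
for all `t`: bound `BIG ≤` a polynomial `B` (`isPBounded_PW_BIG`), `B(t) + 2 ≤ (t+2)^{c}` for a
power of two `c` (`UHSParam.exists_pow_bound`), and `log (t+2)^c < c (log (t+2) + 1)`.
[Hirahara 2021 (ECCC TR21-058), proof of Claim 8.10 (the choice `k' := k + O(log t)`)] [folklore] -/
theorem exists_slack_const : ∃ c : ℕ, 1 ≤ c ∧ ∀ t : ℕ, Nat.log 2 (K.BIG t) + 1 ≤ lam c t := by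
  open AlgebraicComplexity in
  obtain ⟨B, hB⟩ := (isPBounded_iff_exists_polynomial_holds _).1 K.isPBounded_PW_BIG.2
  obtain ⟨d, -, hd⟩ := UHSParam.exists_pow_bound B
  refine ⟨2 ^ d, Nat.one_le_two_pow, fun t => ?_⟩
  set c := 2 ^ d with hc
  have h1 : K.BIG t ≤ (t + 2) ^ c := (hB t).trans (by have := hd t; omega)
  have h2 : (t + 2) ^ c < 2 ^ (c * (Nat.log 2 (t + 2) + 1)) := by
    rw [pow_mul']
    exact Nat.pow_lt_pow_left (Nat.lt_pow_succ_log_self one_lt_two (t + 2)) (by positivity)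
  have h3 : Nat.log 2 (K.BIG t) < c * (Nat.log 2 (t + 2) + 1) :=
    lt_of_le_of_lt (Nat.log_mono_right h1) (Nat.log_lt_of_lt_pow (by positivity) h2)
  unfold lam
  omega

/-- **Choice of the polynomial of the scheme.** For every `c, T₁` there is a polynomial `Q` with
`PW(t) ≤ Q(t)` and `n + c₀ + T₁ ≤ Q(n)`. [folklore] -/
theorem exists_scheme_poly (T₁ : ℕ) :
    ∃ Q : Polynomial ℕ, (∀ t, K.PW t ≤ Q.eval t) ∧ (∀ n, n + K.c₀ + T₁ ≤ Q.eval n) := by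
  open AlgebraicComplexity in
  obtain ⟨B, hB⟩ := (isPBounded_iff_exists_polynomial_holds _).1 K.isPBounded_PW_BIG.1
  refine ⟨B + Polynomial.X + Polynomial.C (K.c₀ + T₁), fun t => ?_, fun n => ?_⟩
  · simp only [Polynomial.eval_add, Polynomial.eval_X, Polynomial.eval_C]
    have := hB t
    omega
  · simp only [Polynomial.eval_add, Polynomial.eval_X, Polynomial.eval_C]
    omega

/-- **Good parameters exist.** There are a slack constant `c` and a polynomial `Q` such that for all
`x` (length `n`), `t ≥ Q(n)` and `k ≤ n + a₀`: `t ≥ c₀`, `p_w(32T) ≤ Q(t)` and the slack `Λ(t)`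
dominates `log t' + log p_w(32T) + log p♯(ι') + 2` — the hypotheses of Claim 8.10 with `q := Q`.
[Hirahara 2021 (ECCC TR21-058), proof of Thm. 8.9 and Claim 8.10 (choice of `q(t) := p_w(t'')` and
of `k'`)] [cite: Hirahara2021, Claim 8.10 (proof)] -/
theorem exists_good_params : ∃ (c : ℕ) (Q : Polynomial ℕ), ∀ (x : List Bool) (t k : ℕ),
    Q.eval x.length ≤ t → k ≤ x.length + K.a₀ →
      K.c₀ ≤ t ∧ K.pw.eval (K.TT c x t k * 32) ≤ Q.eval t ∧
        Nat.log 2 (K.tP x.length t) + Nat.log 2 (K.pw.eval (K.TT c x t k * 32)) +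
          Nat.log 2 (K.pc.eval (K.idxP c x t k)) + 2 ≤ lam c t := by
  obtain ⟨c, -, hc⟩ := K.exists_slack_const
  obtain ⟨Q, hQ1, hQ2⟩ := K.exists_scheme_poly (2 ^ (2 * c + 4))
  refine ⟨c, Q, fun x t k hQt hk => ?_⟩
  have hQn := hQ2 x.length
  have hpos : 0 < 2 ^ (2 * c + 4) := Nat.two_pow_pos _
  have hn : x.length ≤ t := by omega
  have ht : K.c₀ ≤ t := by omega
  have hl : lam c t ≤ t := lam_le_self (by omega)
  obtain ⟨-, h8, -⟩ := K.params_le c hn ht hk hl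
  refine ⟨ht, h8.trans (hQ1 t), ?_⟩
  have := K.log_sum_le_log_BIG c hn ht hk hl
  have := hc t
  omega

/-! ### The scheme with capped `k` and its correctness (Def. 8.8) -/

/-- The capped depth parameter `k̄ := min k (n + a₀)` (since `cd^{t,q(t)}(x) ≤ K^t(x) ≤ n + a₀`,
nothing is lost). [Hirahara 2021 (ECCC TR21-058), proof of Thm. 8.9] [folklore] -/
def kCap (x : List Bool) (k : ℕ) : ℕ := min k (x.length + K.a₀)

/-- **The checker `C(x; 1ᵗ, 1ᵏ) := C₀(x; 1ᵗ, 1^{k̄})`.** [Hirahara 2021 (ECCC TR21-058), proof of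
Thm. 8.9 (the checker `C`)] [cite: Hirahara2021, Thm. 8.9 (proof)] -/
def checker (c : ℕ) (x : List Bool) (t k : ℕ) : Bool :=
  K.checkerCore c x t (K.kCap x k)

/-- **The solver `S(x; 1ᵗ, 1ᴹ) := S₀(x; 1ᵗ, min (log M) (n + a₀))`** (so that `S(x; 1ᵗ, 1^{2^k}) =
S₀(x; 1ᵗ, k̄)`). [Hirahara 2021 (ECCC TR21-058), proof of Thm. 8.9 (the solver `S`)]
[cite: Hirahara2021, Thm. 8.9 (proof)] -/
noncomputable def solver (c : ℕ) (x : List Bool) (t M : ℕ) : List Bool :=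
  K.solverCore c x t (K.kCap x (Nat.log 2 M))

/-- **Correctness of the scheme (Thm. 8.9 for `UP`, items (1) and (2) of Def. 8.8).** If every input
has at most one certificate, there are a slack constant `c` and a polynomial `q` such that for all
`x`, all `t ≥ q(|x|)` and all `k`: (1) `cd^{t,q(t)}(x) ≤ k ⟹ C(x; 1ᵗ, 1ᵏ) = 1` (Claim 8.10), and
(2) `C(x; 1ᵗ, 1ᵏ) = 1` and `x` has a certificate `⟹ S(x; 1ᵗ, 1^{2^k})` is a certificate of `x`
(Claim 8.11). Polynomial running time is established separately.
[Hirahara 2021 (ECCC TR21-058), Thm. 8.9, Claims 8.10–8.11] [cite: Hirahara2021, Thm. 8.9] -/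
theorem scheme_correct (hsub : ∀ x : List Bool, (certSet R p x).Subsingleton) :
    ∃ (c : ℕ) (q : Polynomial ℕ), ∀ (x : List Bool) (t k : ℕ), q.eval x.length ≤ t →
      (U.cdAt t (q.eval t) x ≤ k → K.checker c x t k = true) ∧
      (K.checker c x t k = true → (∃ y, y ∈ certSet R p x) → K.solver c x t (2 ^ k) ∈ certSet R p x) := by
  obtain ⟨c, Q, hQ⟩ := K.exists_good_params
  refine ⟨c, Q, fun x t k hQt => ?_⟩
  have hcap : K.kCap x k ≤ x.length + K.a₀ := min_le_right _ _
  obtain ⟨ht, hq, hlam⟩ := hQ x t (K.kCap x k) hQt hcap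
  refine ⟨fun hcd => ?_, fun hacc hx => ?_⟩
  · -- (1): the depth is at most `K^t(x) ≤ n + a₀`, so capping `k` is harmless
    have hcd' : U.cdAt t (Q.eval t) x ≤ (K.kCap x k : ℕ) := by
      have hbound : U.cdAt t (Q.eval t) x ≤ ((x.length + K.a₀ : ℕ) : ℕ∞) :=
        (tsub_le_self).trans (by exact_mod_cast K.kt_le x t ht)
      unfold kCap
      rcases le_total k (x.length + K.a₀) with hle | hle
      · rw [min_eq_left hle]
        exact hcd
      · rw [min_eq_right hle]
        exact hbound
    exact K.checkerCore_eq_true hsub c ht hcd' hq hlam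
  · -- (2)
    have h := K.solverCore_mem_certSet c ht hacc hx
    have hlog : Nat.log 2 (2 ^ k) = k := Nat.log_pow one_lt_two k
    unfold solver
    rw [hlog]
    exact h

end UPToolkit


end UniversalMachine

end Literature.Computability.MetaComplexity
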